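import Summits.CriticalPhenomena.PercolationContinuityZ3.Theorems.PercNearOneGluingNoHeavyPcintChordDiagramLaw
import HarnessLib

/-!
# CriticalPhenomena/PercolationContinuityZ3 — Theorems/PercNearOneGluingNoHeavyPcintChordDiagrams.lean: IRREDUCIBLE CHORD DIAGRAMS on a finite linear order — blocks, gluing, candidates (combinatorial core of STRUCTURE law C5-L1, part 1)

Lane prim-pcint, STRUCTURE rule «numerics ⇒ structure ⇒ conjecture» (prim-pcint-2 GEN 20).  The typed law C5-L1 `polygonLeadingCoeffLaw`
(…PcintChordDiagramLaw: the leading coefficient of the rooted oriented `2m`-gon count of `ℤ^d` is the connected-chord-diagram number `a(m)`) rests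
on one combinatorial identity: the self-avoiding `2m`-step return words that use `m` axes twice each are exactly the (labelled, oriented) chord
diagrams on the `2m` linearly ordered steps NONE OF WHOSE PROPER BLOCKS OF CONSECUTIVE STEPS IS A UNION OF CHORDS, and these are counted by the
Touchard–Riordan numbers `a(m)` (`a(n) = (n−1)·Σ a(k)a(n−k)`).  This file sets up the abstract objects:

* a CHORD DIAGRAM on a finite linear order `α` is a fixed-point-free involution `π : α → α` (`IsDiag`); a finset `I ⊆ α` is a BLOCK if it is
  order-convex (`Convex`) and `π`-closed (`Closed`); the diagram is IRREDUCIBLE (`IsGood`; classically "connected"/"linked") if its only blocks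
  are `∅` and `α`; `goodSet α` is the finite set of irreducible diagrams;
* restriction of a diagram to a part (`restr`) and gluing of two diagrams on complementary parts (`glue`), with the **gluing lemma**
  `isGood_glue`: parts irreducible on `Sᶜ` and on `S` glue to an irreducible diagram as soon as neither `S` nor `Sᶜ` is convex;
* SHAPES (`IsShape b z R`: non-empty convex `R` avoiding the bottom `b` and the top `z`, with a non-top point above it) and CANDIDATES of `π`
  (`IsCand`: shapes containing the partner `π z` of the top with `R ∪ {z}` closed); candidates are closed under union (`IsCand.union`), the
  largest candidate `rmax` contains every candidate (`subset_rmax`), and for an irreducible diagram on `≥ 3` points `{π z}` is a candidate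
  (`isCand_singleton`); a shape union the top, and its complement, are not convex (`IsShape.not_convex_insert/compl`).
The decomposition theorem built on this (irreducible diagrams ↔ (shape, irreducible outer part, irreducible inner part)) is the sequel
…PcintChordDiagramDecomp; the count `#goodSet (Fin 2n) = connChord n` follows in …PcintChordDiagramCount.

HONEST FRAMING: elementary finite combinatorics written for the proof of `polygonLeadingCoeffLaw` (all `m`).  No `sorry`; standard axioms.
Sources (numbers and recurrence; the set-up is ours): J. Touchard, Canad. J. Math. 4 (1952) 2–25; J. Riordan, Math. Comp. 29 (1975) 215–222;
P. R. Stein, J. Combin. Theory A 24 (1978) 357–366; A. Nijenhuis, H. S. Wilf, J. Combin. Theory A 27 (1979) 356–359; P. Flajolet, M. Noy, Analytic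
combinatorics of chord diagrams, FPSAC 2000.  Written by prim-pcint-2 gen 20 (prover-prim-pcint-2-g20-0), 2026-08-26.
-/

namespace Summit.CriticalPhenomena.PercolationContinuityZ3.Theorems.Pcint.ChordDiag

variable {α : Type*} [LinearOrder α] [Fintype α]

/-! ### Blocks, diagrams, irreducibility -/

/-- `I` is closed under `π`. [folklore] -/
def Closed (π : α → α) (I : Finset α) : Prop := ∀ ⦃t⦄, t ∈ I → π t ∈ I

/-- `I` is order-convex (an interval of the finite linear order). [folklore] -/
def Convex (I : Finset α) : Prop := ∀ ⦃x⦄, x ∈ I → ∀ ⦃y⦄, y ∈ I → ∀ ⦃t⦄, x ≤ t → t ≤ y → t ∈ I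

/-- A chord diagram on `α`: a fixed-point-free involution. [folklore] -/
def IsDiag (π : α → α) : Prop := ∀ t, π (π t) = t ∧ π t ≠ t

/-- An IRREDUCIBLE (connected, linked) chord diagram: its only convex closed blocks are `∅` and everything. [folklore] -/
def IsGood (π : α → α) : Prop := IsDiag π ∧ ∀ I : Finset α, Convex I → Closed π I → I = ∅ ∨ I = Finset.univ

open Classical in
/-- The finite set of irreducible chord diagrams on `α`. [folklore] -/
noncomputable def goodSet (α : Type*) [LinearOrder α] [Fintype α] : Finset (α → α) :=
  Finset.univ.filter fun π => IsGood π

/-- Membership in `goodSet`. [folklore] -/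
theorem mem_goodSet {π : α → α} : π ∈ goodSet α ↔ IsGood π := by
  simp [goodSet]

omit [LinearOrder α] [Fintype α] in
/-- A diagram is injective. [folklore] -/
theorem IsDiag.injective {π : α → α} (h : IsDiag π) : Function.Injective π := fun s t hst => by
  rw [← (h s).1, ← (h t).1, hst]

/-- The complement of a closed set is closed (involution). [folklore] -/
theorem IsDiag.closed_compl {π : α → α} (h : IsDiag π) {I : Finset α} (hI : Closed π I) : Closed π Iᶜ := by
  intro t ht
  rw [Finset.mem_compl] at ht ⊢
  intro h'
  exact ht ((h t).1 ▸ hI h')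

omit [Fintype α] in
/-- The difference of closed sets is closed (involution). [folklore] -/
theorem IsDiag.closed_sdiff {π : α → α} (h : IsDiag π) {I J : Finset α} (hI : Closed π I) (hJ : Closed π J) :
    Closed π (I \ J) := by
  intro t ht
  rw [Finset.mem_sdiff] at ht ⊢
  refine ⟨hI ht.1, fun h' => ht.2 ?_⟩
  exact (h t).1 ▸ hJ h'

omit [Fintype α] in
/-- The union of two convex sets with a common point is convex. [folklore] -/
theorem Convex.union {I J : Finset α} (hI : Convex I) (hJ : Convex J) {j : α} (hjI : j ∈ I) (hjJ : j ∈ J) :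
    Convex (I ∪ J) := by
  intro x hx y hy t hxt hty
  rw [Finset.mem_union] at hx hy ⊢
  rcases le_total t j with htj | hjt
  · rcases hx with hx | hx
    · exact Or.inl (hI hx hjI hxt htj)
    · exact Or.inr (hJ hx hjJ hxt htj)
  · rcases hy with hy | hy
    · exact Or.inl (hI hjI hy hjt hty)
    · exact Or.inr (hJ hjJ hy hjt hty)

/-! ### Restriction to a part and gluing of two parts -/

/-- Restriction of `π` to a finset `S` (total: identity where `π` leaves `S`; the true restriction when `S` is closed). [folklore] -/
def restr (π : α → α) (S : Finset α) : S → S := fun x => if h : π x.1 ∈ S then ⟨π x.1, h⟩ else x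

omit [Fintype α] in
/-- On a closed part the restriction is `π`. [folklore] -/
theorem restr_val {π : α → α} {S : Finset α} (hS : Closed π S) (x : S) : ((restr π S x) : α) = π x := by
  simp [restr, hS x.2]

/-- Gluing a map on `Sᶜ` and a map on `S`. [folklore] -/
def glue (S : Finset α) (πA : ↥(Sᶜ) → ↥(Sᶜ)) (πB : S → S) : α → α :=
  fun x => if h : x ∈ S then ((πB ⟨x, h⟩) : α) else ((πA ⟨x, Finset.mem_compl.2 h⟩) : α)

variable {S : Finset α} {πA : ↥(Sᶜ) → ↥(Sᶜ)} {πB : S → S}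

/-- `glue` on `S`. [folklore] -/
theorem glue_apply_mem {x : α} (h : x ∈ S) : glue S πA πB x = πB ⟨x, h⟩ := by
  simp [glue, h]

/-- `glue` off `S`. [folklore] -/
theorem glue_apply_not_mem {x : α} (h : x ∉ S) : glue S πA πB x = πA ⟨x, Finset.mem_compl.2 h⟩ := by
  simp [glue, h]

/-- `glue` on an element of the subtype `S`. [folklore] -/
theorem glue_coe_mem (x : S) : glue S πA πB x = πB x := by
  rw [glue_apply_mem x.2]

/-- `glue` on an element of the subtype `Sᶜ`. [folklore] -/
theorem glue_coe_compl (x : ↥(Sᶜ)) : glue S πA πB x = πA x := by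
  rw [glue_apply_not_mem (Finset.mem_compl.1 x.2)]

/-- `glue` maps `S` into `S`. [folklore] -/
theorem closed_glue : Closed (glue S πA πB) S := fun x hx => by
  rw [glue_apply_mem hx]; exact (πB ⟨x, hx⟩).2

/-- `glue` maps `Sᶜ` into `Sᶜ`. [folklore] -/
theorem closed_compl_glue : Closed (glue S πA πB) Sᶜ := fun x hx => by
  rw [glue_apply_not_mem (Finset.mem_compl.1 hx)]; exact (πA ⟨x, hx⟩).2

/-- Restricting a glued map to `S` returns the second part. [folklore] -/
theorem restr_glue_right : restr (glue S πA πB) S = πB := by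
  funext x
  apply Subtype.ext
  rw [restr_val closed_glue, glue_coe_mem]

/-- Restricting a glued map to `Sᶜ` returns the first part. [folklore] -/
theorem restr_glue_left : restr (glue S πA πB) Sᶜ = πA := by
  funext x
  apply Subtype.ext
  rw [restr_val closed_compl_glue, glue_coe_compl]

/-- A map closed on `S` is the gluing of its two restrictions. [folklore] -/
theorem glue_restr {π : α → α} (hd : IsDiag π) (hS : Closed π S) : glue S (restr π Sᶜ) (restr π S) = π := by
  funext x
  by_cases hx : x ∈ S
  · rw [glue_apply_mem hx, restr_val hS]
  · rw [glue_apply_not_mem hx, restr_val (hd.closed_compl hS)]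

omit [Fintype α] in
/-- The restriction of a diagram to a closed part is a diagram. [folklore] -/
theorem IsDiag.restr {π : α → α} (hd : IsDiag π) (hS : Closed π S) : IsDiag (restr π S) := by
  intro x
  constructor
  · apply Subtype.ext
    rw [restr_val hS, restr_val hS]
    exact (hd x).1
  · intro h
    have := congrArg Subtype.val h
    rw [restr_val hS] at this
    exact (hd x).2 this

/-- Gluing two diagrams gives a diagram. [folklore] -/
theorem IsDiag.glue (hA : IsDiag πA) (hB : IsDiag πB) : IsDiag (glue S πA πB) := by
  intro x
  by_cases hx : x ∈ S
  · rw [glue_apply_mem hx, glue_coe_mem]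
    exact ⟨congrArg Subtype.val (hB ⟨x, hx⟩).1, fun h => (hB ⟨x, hx⟩).2 (Subtype.ext h)⟩
  · rw [glue_apply_not_mem hx, glue_coe_compl]
    exact ⟨congrArg Subtype.val (hA ⟨x, Finset.mem_compl.2 hx⟩).1, fun h => (hA ⟨x, _⟩).2 (Subtype.ext h)⟩

omit [Fintype α] in
/-- A convex set of `α` pulls back to a convex set of a part. [folklore] -/
theorem Convex.subtype {I : Finset α} (hI : Convex I) (p : α → Prop) [DecidablePred p] : Convex (I.subtype p) := by
  intro x hx y hy t hxt hty
  rw [Finset.mem_subtype] at hx hy ⊢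
  exact hI hx hy hxt hty

/-- **Gluing lemma**: irreducible parts on `Sᶜ` and `S` glue to an irreducible diagram as soon as neither `S` nor `Sᶜ` is convex. [folklore] -/
theorem isGood_glue (hA : IsGood πA) (hB : IsGood πB) (hS : ¬ Convex S) (hSc : ¬ Convex Sᶜ) : IsGood (glue S πA πB) := by
  refine ⟨hA.1.glue hB.1, fun I hIc hIcl => ?_⟩
  -- the traces of `I` on the two parts are convex closed blocks there
  set IA : Finset ↥(Sᶜ) := I.subtype (· ∈ Sᶜ) with hIA
  set IB : Finset ↥S := I.subtype (· ∈ S) with hIB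
  have hAc : Convex IA := hIc.subtype _
  have hBc : Convex IB := hIc.subtype _
  have hAcl : Closed πA IA := fun x hx => by
    rw [hIA, Finset.mem_subtype] at hx ⊢
    have := hIcl hx
    rwa [glue_coe_compl] at this
  have hBcl : Closed πB IB := fun x hx => by
    rw [hIB, Finset.mem_subtype] at hx ⊢
    have := hIcl hx
    rwa [glue_coe_mem] at this
  have memA : ∀ {t : α} (ht : t ∉ S), t ∈ I ↔ (⟨t, Finset.mem_compl.2 ht⟩ : ↥(Sᶜ)) ∈ IA := fun ht => by
    rw [hIA, Finset.mem_subtype]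
  have memB : ∀ {t : α} (ht : t ∈ S), t ∈ I ↔ (⟨t, ht⟩ : ↥S) ∈ IB := fun ht => by rw [hIB, Finset.mem_subtype]
  rcases hA.2 IA hAc hAcl with hA0 | hA1 <;> rcases hB.2 IB hBc hBcl with hB0 | hB1
  · -- both traces empty: `I = ∅`
    left
    refine Finset.eq_empty_iff_forall_notMem.2 fun t ht => ?_
    by_cases hts : t ∈ S
    · have := (memB hts).1 ht; rw [hB0] at this; exact Finset.notMem_empty _ this
    · have := (memA hts).1 ht; rw [hA0] at this; exact Finset.notMem_empty _ this
  · -- `I = S`, not convex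
    exfalso; apply hS
    have hIS : I = S := by
      ext t
      by_cases hts : t ∈ S
      · simp only [hts, iff_true]; exact (memB hts).2 (Finset.eq_univ_iff_forall.1 hB1 _)
      · simp only [hts, iff_false]; intro ht
        have := (memA hts).1 ht; rw [hA0] at this; exact Finset.notMem_empty _ this
    rwa [hIS] at hIc
  · -- `I = Sᶜ`, not convex
    exfalso; apply hSc
    have hIS : I = Sᶜ := by
      ext t
      rw [Finset.mem_compl]
      by_cases hts : t ∈ S
      · simp only [hts, not_true_eq_false, iff_false]; intro ht
        have := (memB hts).1 ht; rw [hB0] at this; exact Finset.notMem_empty _ this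
      · simp only [hts, not_false_eq_true, iff_true]; exact (memA hts).2 (Finset.eq_univ_iff_forall.1 hA1 _)
    rwa [hIS] at hIc
  · -- both traces full: `I = univ`
    right
    refine Finset.eq_univ_iff_forall.2 fun t => ?_
    by_cases hts : t ∈ S
    · exact (memB hts).2 (Finset.eq_univ_iff_forall.1 hB1 _)
    · exact (memA hts).2 (Finset.eq_univ_iff_forall.1 hA1 _)

/-! ### Shapes and candidates; the largest candidate -/

/-- A SHAPE relative to bottom `b` and top `z`: a non-empty convex set avoiding `b` and `z` with a non-top point above it. [folklore] -/
def IsShape (b z : α) (R : Finset α) : Prop :=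
  R.Nonempty ∧ Convex R ∧ z ∉ R ∧ b ∉ R ∧ ∃ u, u ∉ R ∧ u ≠ z ∧ ∀ r ∈ R, r < u

/-- A CANDIDATE block of `π`: a shape containing the partner of the top, with `R ∪ {z}` closed. [folklore] -/
def IsCand (π : α → α) (b z : α) (R : Finset α) : Prop := IsShape b z R ∧ π z ∈ R ∧ Closed π (insert z R)

open Classical in
/-- The finite set of shapes. [folklore] -/
noncomputable def shapeSet (b z : α) : Finset (Finset α) := Finset.univ.filter fun R => IsShape b z R

open Classical in
/-- The finite set of candidates of `π`. [folklore] -/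
noncomputable def candSet (π : α → α) (b z : α) : Finset (Finset α) := Finset.univ.filter fun R => IsCand π b z R

/-- Membership in `shapeSet`. [folklore] -/
theorem mem_shapeSet {b z : α} {R : Finset α} : R ∈ shapeSet b z ↔ IsShape b z R := by
  simp [shapeSet]

/-- Membership in `candSet`. [folklore] -/
theorem mem_candSet {π : α → α} {b z : α} {R : Finset α} : R ∈ candSet π b z ↔ IsCand π b z R := by
  simp [candSet]

/-- The LARGEST candidate (the union of all candidates). [folklore] -/
noncomputable def rmax (π : α → α) (b z : α) : Finset α := (candSet π b z).sup id

/-- Every candidate is contained in `rmax`. [folklore] -/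
theorem subset_rmax {π : α → α} {b z : α} {R : Finset α} (h : IsCand π b z R) : R ⊆ rmax π b z :=
  Finset.le_sup (f := id) (mem_candSet.2 h)

omit [Fintype α] in
/-- Candidates are closed under union. [folklore] -/
theorem IsCand.union {π : α → α} {b z : α} {R₁ R₂ : Finset α} (h₁ : IsCand π b z R₁) (h₂ : IsCand π b z R₂) :
    IsCand π b z (R₁ ∪ R₂) := by
  obtain ⟨⟨-, hc₁, hz₁, hb₁, u₁, hu₁, hu₁z, hu₁'⟩, hj₁, hcl₁⟩ := h₁
  obtain ⟨⟨-, hc₂, hz₂, hb₂, u₂, hu₂, hu₂z, hu₂'⟩, hj₂, hcl₂⟩ := h₂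
  refine ⟨⟨⟨π z, Finset.mem_union_left _ hj₁⟩, hc₁.union hc₂ hj₁ hj₂, by simp [hz₁, hz₂], by simp [hb₁, hb₂], ?_⟩,
    Finset.mem_union_left _ hj₁, ?_⟩
  · -- the larger of the two witnesses lies above the union
    rcases le_total u₁ u₂ with h | h
    · refine ⟨u₂, ?_, hu₂z, fun r hr => ?_⟩
      · rw [Finset.mem_union, not_or]
        exact ⟨fun hr => absurd h (not_le.2 (hu₁' _ hr)), hu₂⟩
      · rcases Finset.mem_union.1 hr with hr | hr
        · exact (hu₁' r hr).trans_le h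
        · exact hu₂' r hr
    · refine ⟨u₁, ?_, hu₁z, fun r hr => ?_⟩
      · rw [Finset.mem_union, not_or]
        exact ⟨hu₁, fun hr => absurd h (not_le.2 (hu₂' _ hr))⟩
      · rcases Finset.mem_union.1 hr with hr | hr
        · exact hu₁' r hr
        · exact (hu₂' r hr).trans_le h
  · intro t ht
    rw [Finset.insert_union_distrib, Finset.mem_union] at ht ⊢
    rcases ht with ht | ht
    · exact Or.inl (hcl₁ ht)
    · exact Or.inr (hcl₂ ht)

section Top

variable {π : α → α} {b z : α}

/-- For an irreducible diagram on at least three points, the singleton of the partner of the top is a candidate. [folklore] -/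
theorem isCand_singleton (hg : IsGood π) (hb : ∀ x, b ≤ x) (hz : ∀ x, x ≤ z) (h3 : 3 ≤ Fintype.card α) :
    IsCand π b z {π z} := by
  have hd := hg.1
  have hjz : π z ≠ z := (hd z).2
  have hzj : π (π z) = z := (hd z).1
  -- the pair `{π z, z}` is a closed block; its complement is closed too
  have hpair : Closed π (insert z {π z}) := by
    intro t ht
    simp only [Finset.mem_insert, Finset.mem_singleton] at ht ⊢
    rcases ht with rfl | rfl
    · exact Or.inr rfl
    · exact Or.inl hzj
  -- a third point
  have hthird : ∃ w, w ≠ z ∧ w ≠ π z := by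
    by_contra h
    push Not at h
    have hsub : (Finset.univ : Finset α) ⊆ {z, π z} := fun w _ => by
      by_cases hw : w = z
      · simp [hw]
      · simp [h w hw]
    have := (Finset.card_le_card hsub).trans (Finset.card_insert_le _ _)
    rw [Finset.card_singleton, Finset.card_univ] at this
    omega
  refine ⟨⟨⟨π z, Finset.mem_singleton_self _⟩, ?_, by simpa using hjz.symm, ?_, ?_⟩, Finset.mem_singleton_self _, hpair⟩
  · intro x hx y hy t hxt hty
    rw [Finset.mem_singleton] at hx hy ⊢
    subst hx; subst hy; exact le_antisymm hty hxt
  · -- `π z ≠ b`: otherwise the middle `α ∖ {b, z}` is a proper non-empty block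
    rw [Finset.mem_singleton]
    intro hbj
    have hmid := hg.2 ({z, π z} : Finset α)ᶜ ?_ (hd.closed_compl hpair)
    · rcases hmid with h0 | h1
      · obtain ⟨w, hwz, hwj⟩ := hthird
        have : w ∈ ({z, π z} : Finset α)ᶜ := by simp [hwz, hwj]
        rw [h0] at this; exact Finset.notMem_empty _ this
      · have : z ∈ ({z, π z} : Finset α)ᶜ := Finset.eq_univ_iff_forall.1 h1 _
        simp at this
    · intro x hx y hy t hxt hty
      simp only [Finset.mem_compl, Finset.mem_insert, Finset.mem_singleton, not_or] at hx hy ⊢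
      refine ⟨fun htz => hy.1 (le_antisymm (hz y) (htz ▸ hty)), fun htj => hx.2 ?_⟩
      have hxb : x ≤ b := by rw [hbj, ← htj]; exact hxt
      rw [← hbj]
      exact le_antisymm hxb (hb x)
  · -- some non-top point above `π z`: otherwise `{π z, z}` is a proper non-empty block
    by_contra h
    push Not at h
    have hblock := hg.2 (insert z {π z}) ?_ hpair
    · rcases hblock with h0 | h1
      · simp at h0
      · obtain ⟨w, hwz, hwj⟩ := hthird
        have : w ∈ insert z ({π z} : Finset α) := Finset.eq_univ_iff_forall.1 h1 _
        simp [hwz, hwj] at this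
    · intro x hx y hy t hxt hty
      simp only [Finset.mem_insert, Finset.mem_singleton] at hx hy ⊢
      by_contra ht
      rw [not_or] at ht
      have hjt : π z < t := by
        rcases hx with rfl | rfl
        · exact absurd (le_antisymm (hz t) hxt) ht.1
        · exact lt_of_le_of_ne hxt (Ne.symm ht.2)
      obtain ⟨r, hr, htr⟩ := h t (by simpa using ht.2) ht.1
      rw [Finset.mem_singleton] at hr
      rw [hr] at htr
      exact absurd hjt (not_lt.2 htr)


end Top

/-! ### Gluing along a shape: the largest candidate of the glued diagram is the shape -/

omit [Fintype α] in
/-- A shape union the top is not convex (a non-top point lies above the shape). [folklore] -/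
theorem IsShape.not_convex_insert {b z : α} {R : Finset α} (hR : IsShape b z R) (hz : ∀ x, x ≤ z) :
    ¬ Convex (insert z R) := by
  obtain ⟨⟨r, hr⟩, -, hzR, -, u, huR, huz, hu⟩ := hR
  intro h
  have := h (Finset.mem_insert_of_mem hr) (Finset.mem_insert_self z R) (hu r hr).le (hz u)
  rw [Finset.mem_insert] at this
  rcases this with h | h
  · exact huz h
  · exact huR h

/-- The complement of a shape union the top is not convex (the shape separates the bottom from the point above it). [folklore] -/
theorem IsShape.not_convex_compl {b z : α} {R : Finset α} (hR : IsShape b z R) (hb : ∀ x, b ≤ x) (hz : ∀ x, x ≤ z) :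
    ¬ Convex (insert z R)ᶜ := by
  obtain ⟨⟨r, hr⟩, -, hzR, hbR, u, huR, huz, hu⟩ := hR
  intro h
  have hbz : b ≠ z := fun hbz => huz (le_antisymm (hz u) (by rw [← hbz]; exact hb u))
  have hbS : b ∈ (insert z R)ᶜ := by simp [hbR, hbz]
  have huS : u ∈ (insert z R)ᶜ := by simp [huR, huz]
  have := h hbS huS (hb r) (hu r hr).le
  simp [hr] at this


end Summit.CriticalPhenomena.PercolationContinuityZ3.Theorems.Pcint.ChordDiag
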